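import Summits.CriticalPhenomena.PercolationContinuityZ3.Theorems.PercNearOneGluingNoHeavyQuantSGCGiantStep
import Summits.CriticalPhenomena.PercolationContinuityZ3.Theorems.PercNearOneGluingNoHeavyQuantSGCGiantStepExchange
import Summits.CriticalPhenomena.PercolationContinuityZ3.Theorems.PercNearOneGluingNoHeavyQuantSGCLightPairRemainder
import Summits.CriticalPhenomena.PercolationContinuityZ3.Theorems.PercNearOneGluingNoHeavyQuantGatedConvSplit
import HarnessLib

/-!
# QUANT lane R8, T-DEC: the NP-branch GIANT STEP, part 2 — the kernel reduction `SGCGiantStep ⟹ SingleGateConvClosed ⟹ FarTreeRow`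
# and the converse: `SGCGiantStep ⟺ SingleGateConvClosed` (the node is SGC in normal form)

builds on p205010 (kernel theorem, internal audit signed; external expert review pending)

Support file (`--supports stmt-CriticalPhenomena-4575`), QUANT lane TYPER seat prim-quant-stmt (gen 33), rung R8 of
`run/shared/lean/prim/quant/LADDER.md`.  Pure theorems (standard axioms, no sorries) over part 1 (`…QuantSGCGiantStep`: `LawDec.PartialMidFlow`,
`@[conjecture] LawDec.SGCGiantStep`), part 3 (`…QuantSGCGiantStepExchange`: `LawDec.partialMidFlow_dichotomy_of_flowAtT`) and arm-2 g37's
dichotomy `LawDec.flowAtT_of_partial_dichotomy` (`…QuantSGCLightPairRemainder`).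

At a layer `j < M₁ + M₂` of the gated product `L = gate (lconv M₁ M₂ μ₁ μ₂) q`: DEC(j) is the flow form at the mean (`decAt_iff_flowAt`);
if some partial mid-flow places every nonzero low, `flowAtT_of_partial_dichotomy` closes by its first-moment branch (a theorem: every placed
pair has mean `≤` the target under top-affordability); otherwise the node `SGCGiantStep` hands a partial mid-flow whose leftovers, with the gate
zero, fit the giants, and the same theorem closes by its giant branch.  Hence `SingleGateConvClosed`, and through lead g28's
`…QuantSingleGateClosure` also `SDECConvClosed`, `TreeBuiltDEC`, `Quant.FarTreeRow` — ROUTE 1 of R8-on-trees from ONE scalar node.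

* `LawDec.gate_lconv_laws` — the gated product of two probability laws is a probability law on `{0..M₁+M₂}` with mean `q·(T₁ + T₂)`.
* **`LawDec.singleGateConvClosed_of_giantStep : SGCGiantStep → SingleGateConvClosed`**; `sdecConvClosed_of_giantStep`,
  `treeBuiltDEC_of_giantStep`, **`Quant.farTreeRow_of_giantStep : SGCGiantStep → FarTreeRow`**.
* **`LawDec.sgcGiantStep_of_singleGateConvClosed : SingleGateConvClosed → SGCGiantStep`** (the flow of the gated product at the layer, read
  through the zero-eviction exchange of part 3: if no partial mid-flow places every nonzero low, the exchange's flow is in the giant branch) and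
  **`LawDec.sgcGiantStep_iff_singleGateConvClosed : SGCGiantStep ↔ SingleGateConvClosed`** — the node is EXACTLY `SingleGateConvClosed`,
  re-typed so that its one inequality and the layers where the factors' data are needed are explicit.

HONEST STATUS: `SGCGiantStep` is an OPEN conjecture (exact evidence in part 1's docstring); everything here is conditional on it; the RATE
class log\* and the honest sentence of `run/shared/lean/prim/quant/README.md` are unchanged.
[this work]; dichotomy: prim-quant-arm-2 g37; `SingleGateConvClosed` and its consequences: prim-quant-lead g28 (this lane).  The gluing rows
served [cite: KozmaNitzan2024, Conjecture 3 (p. 15)]; product measure [cite: Grimmett1999, §1.3 p. 10].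
-/

noncomputable section

namespace Summit.CriticalPhenomena.PercolationContinuityZ3.Theorems

namespace Quant

open Finset

namespace LawDec

/-! ### The reduction -/

/-- **law facts of the gated product** `L = gate (lconv M₁ M₂ μ₁ μ₂) q` of two probability laws (`0 ≤ q ≤ 1`): nonnegative, vanishing above
`M₁ + M₂`, mass `1`, mean `q·(T₁ + T₂)` (vanishing of the factors above their tops is not needed: `lconv` truncates). [this work] -/
theorem gate_lconv_laws (q : ℝ) (M₁ M₂ : ℕ) (μ₁ μ₂ : ℕ → ℝ) (hq0 : 0 ≤ q) (hq1 : q ≤ 1)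
    (h10 : ∀ h, 0 ≤ μ₁ h) (h11 : ∑ h ∈ Finset.range (M₁ + 1), μ₁ h = 1)
    (h20 : ∀ h, 0 ≤ μ₂ h) (h21 : ∑ h ∈ Finset.range (M₂ + 1), μ₂ h = 1) :
    (∀ h, 0 ≤ gate (lconv M₁ M₂ μ₁ μ₂) q h) ∧ (∀ h, M₁ + M₂ < h → gate (lconv M₁ M₂ μ₁ μ₂) q h = 0) ∧
      (∑ h ∈ Finset.range (M₁ + M₂ + 1), gate (lconv M₁ M₂ μ₁ μ₂) q h = 1) ∧
      (∑ h ∈ Finset.range (M₁ + M₂ + 1), (h : ℝ) * gate (lconv M₁ M₂ μ₁ μ₂) q h =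
        q * ((∑ h ∈ Finset.range (M₁ + 1), (h : ℝ) * μ₁ h) + ∑ h ∈ Finset.range (M₂ + 1), (h : ℝ) * μ₂ h)) := by
  obtain ⟨hL0, hLM, hL1⟩ := gate_laws (M₁ + M₂) (lconv M₁ M₂ μ₁ μ₂) q hq0 hq1 (lconv_nonneg M₁ M₂ μ₁ μ₂ h10 h20)
    (fun h hh => lconv_eq_zero M₁ M₂ μ₁ μ₂ h hh) (sum_lconv M₁ M₂ μ₁ μ₂ h11 h21)
  refine ⟨hL0, hLM, hL1, ?_⟩
  rw [sum_mul_gate, sum_mul_lconv M₁ M₂ μ₁ μ₂ h11 h21]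

/-- **`SGCGiantStep ⟹ SingleGateConvClosed`** (the kernel reduction).  At a layer `j < M₁ + M₂`: DEC(j) of the gated product is its flow
form at the mean (`decAt_iff_flowAt`); if some partial mid-flow places every nonzero low, arm-2 g37's `flowAtT_of_partial_dichotomy` closes
by its first-moment branch; otherwise the node hands a partial mid-flow whose leftovers (with the gate zero) fit the giants, and the same theorem
closes by its giant branch. [this work] -/
theorem singleGateConvClosed_of_giantStep (hG : SGCGiantStep) : SingleGateConvClosed := by
  intro y q M₁ M₂ μ₁ μ₂ hy0 hy1 hq0 hq1 h10 h1M h11 hta1 h20 h2M h21 hta2 hD1 hD2 j hj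
  obtain ⟨hL0, hLM, hL1, hmean⟩ := gate_lconv_laws q M₁ M₂ μ₁ μ₂ hq0.le hq1 h10 h11 h20 h21
  set T₁ : ℝ := ∑ h ∈ Finset.range (M₁ + 1), (h : ℝ) * μ₁ h with hT₁
  set T₂ : ℝ := ∑ h ∈ Finset.range (M₂ + 1), (h : ℝ) * μ₂ h with hT₂
  set L : ℕ → ℝ := gate (lconv M₁ M₂ μ₁ μ₂) q with hL
  have hMpos : (1 : ℝ) ≤ ((M₁ + M₂ : ℕ) : ℝ) := by exact_mod_cast (show 1 ≤ M₁ + M₂ by omega)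
  have hta : y * ((M₁ + M₂ : ℕ) : ℝ) ≤ q * (T₁ + T₂) := by push_cast; nlinarith
  have hS : 0 < q * (T₁ + T₂) := lt_of_lt_of_le (by nlinarith) hta
  rw [decAt_iff_flowAt y j (M₁ + M₂) L hy0 hy1 hLM hL1, hmean]
  by_cases hAP : ∃ φ : ℕ → ℕ → ℝ, PartialMidFlow y (q * (T₁ + T₂)) j (M₁ + M₂) L φ ∧
      ∀ t, (1 ≤ t ∧ t ≤ j ∧ 2 * (t : ℝ) < q * (T₁ + T₂)) → ∑ k ∈ Finset.range (M₁ + M₂ + 1), φ t k = L t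
  · obtain ⟨φ, ⟨hφ0, hφsupp, hφz, hcol, hrow⟩, hall⟩ := hAP
    exact flowAtT_of_partial_dichotomy y (q * (T₁ + T₂)) (∑ h ∈ Finset.Ico (j + 1) (M₁ + M₂ + 1), L h) j (M₁ + M₂) L φ
      hy0 hy1 hS hL0 hL1 hmean hta hj hφ0 hφsupp hφz hcol hrow (Or.inr hall)
  · obtain ⟨φ, ⟨hφ0, hφsupp, hφz, hcol, hrow⟩, hGi⟩ :=
      hG y q M₁ M₂ μ₁ μ₂ hy0 hy1 hq0 hq1 h10 h1M h11 hta1 h20 h2M h21 hta2 hD1 hD2 j hj hAP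
    exact flowAtT_of_partial_dichotomy y (q * (T₁ + T₂)) (∑ h ∈ Finset.Ico (j + 1) (M₁ + M₂ + 1), L h) j (M₁ + M₂) L φ
      hy0 hy1 hS hL0 hL1 hmean hta hj hφ0 hφsupp hφz hcol hrow (Or.inl ⟨hGi, le_rfl⟩)

/-- **`SGCGiantStep ⟹ SDECConvClosed`**. [this work] -/
theorem sdecConvClosed_of_giantStep (hG : SGCGiantStep) : SDECConvClosed :=
  sdecConvClosed_of_singleGate (singleGateConvClosed_of_giantStep hG)

/-- **`SGCGiantStep ⟹ TreeBuiltDEC`**: every tree-built count law is DEC at every layer. [this work] -/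
theorem treeBuiltDEC_of_giantStep (hG : SGCGiantStep) : TreeBuiltDEC :=
  treeBuiltDEC_of_singleGate (singleGateConvClosed_of_giantStep hG)

/-! ### The converse: the node is `SingleGateConvClosed` in normal form -/

/-- **`SingleGateConvClosed ⟹ SGCGiantStep`**: at a layer `j < M₁ + M₂`, `SingleGateConvClosed` gives DEC(j) of the gated product, i.e. a
flow at the mean (`decAt_iff_flowAt`); the zero-eviction exchange (`partialMidFlow_dichotomy_of_flowAtT`, part 3) turns it into a partial
mid-flow that places every nonzero low or satisfies the giant inequality — under the node's hypothesis the first is excluded. [this work] -/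
theorem sgcGiantStep_of_singleGateConvClosed (hS : SingleGateConvClosed) : SGCGiantStep := by
  intro y q M₁ M₂ μ₁ μ₂ hy0 hy1 hq0 hq1 h10 h1M h11 hta1 h20 h2M h21 hta2 hD1 hD2 j hj hNP
  obtain ⟨hL0, hLM, hL1, hmean⟩ := gate_lconv_laws q M₁ M₂ μ₁ μ₂ hq0.le hq1 h10 h11 h20 h21
  set T₁ : ℝ := ∑ h ∈ Finset.range (M₁ + 1), (h : ℝ) * μ₁ h with hT₁
  set T₂ : ℝ := ∑ h ∈ Finset.range (M₂ + 1), (h : ℝ) * μ₂ h with hT₂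
  set L : ℕ → ℝ := gate (lconv M₁ M₂ μ₁ μ₂) q with hL
  have hMpos : (1 : ℝ) ≤ ((M₁ + M₂ : ℕ) : ℝ) := by exact_mod_cast (show 1 ≤ M₁ + M₂ by omega)
  have hta : y * ((M₁ + M₂ : ℕ) : ℝ) ≤ q * (T₁ + T₂) := by push_cast; nlinarith
  have hS' : 0 < q * (T₁ + T₂) := lt_of_lt_of_le (by nlinarith) hta
  have hF : FlowAtT y (q * (T₁ + T₂)) j (M₁ + M₂) L := by
    have h := hS y q M₁ M₂ μ₁ μ₂ hy0 hy1 hq0 hq1 h10 h1M h11 hta1 h20 h2M h21 hta2 hD1 hD2 j hj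
    rw [decAt_iff_flowAt y j (M₁ + M₂) L hy0 hy1 hLM hL1, hmean] at h
    exact h
  obtain ⟨φ, hφ0, hφsupp, hφz, hcol, hrow, hdich⟩ :=
    partialMidFlow_dichotomy_of_flowAtT y (q * (T₁ + T₂)) j (M₁ + M₂) L hy0 hy1 hS' hL0 hj hF
  rcases hdich with hall | hGi
  · exact absurd ⟨φ, ⟨hφ0, hφsupp, hφz, hcol, hrow⟩, hall⟩ hNP
  · exact ⟨φ, ⟨hφ0, hφsupp, hφz, hcol, hrow⟩, hGi⟩

/-- **`SGCGiantStep ⟺ SingleGateConvClosed`.** [this work] -/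
theorem sgcGiantStep_iff_singleGateConvClosed : SGCGiantStep ↔ SingleGateConvClosed :=
  ⟨singleGateConvClosed_of_giantStep, sgcGiantStep_of_singleGateConvClosed⟩

end LawDec

/-- **`SGCGiantStep ⟹ Quant.FarTreeRow`** — the R8 tree row from the single scalar node (through `SingleGateConvClosed`). [this work] -/
theorem farTreeRow_of_giantStep (hG : LawDec.SGCGiantStep) : FarTreeRow :=
  farTreeRow_of_singleGate (LawDec.singleGateConvClosed_of_giantStep hG)

end Quant

end Summit.CriticalPhenomena.PercolationContinuityZ3.Theorems
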